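import Summits.MatrixMultiplication.MatrixMultiplication.Theses.DefinableSTPPDichotomy

/-!
# Stub `stub_noLonely_of_alg` of the crux `DefinableSTPPDichotomy.HexagonClearanceR`

Pure plumbing: the formula version of "no lonely generic point for definable translates"
(`NoLonelyTranslateLC`) from

* (i) a normal-form hypothesis `hNF` for ring formulas over large finite fields
  (`φ(w; y) ↔ ⋀_l ∃ t, G_l(w, t) = 0` with polynomials `G_l` of bounded total degree), and
* (ii) the algebraic version `hA` of the no-lonely-point statement for normal-form sets
  (large characteristic).

Proof: fix `m n n' τ α`; take the normal-form data `(L, D, Q)` of `τ` and `(L', D', Q')` of `α`,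
put `D'' := max D D'` and take `(K, Q'', C₀)` from `hA` at `(m, L, L', D'')`; answer with
`K`, `max (max Q Q') Q''`, `C₀`.  In a finite field `ringChar F ≤ Fintype.card F`, so all three
thresholds are met; the realisation hypotheses of `T` and `A` are rewritten through the normal-form
equivalences and `hA` concludes.
-/

set_option linter.dupNamespace false

namespace Summit.MatrixMultiplication.MatrixMultiplication.Theorems.HexagonClearanceR

namespace NoLonelyOfAlg

/-- The characteristic of a finite field is at most its cardinality. -/
theorem ringChar_le_card (F : Type) [Field F] [Fintype F] : ringChar F ≤ Fintype.card F := by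
  obtain ⟨n, _, h⟩ := FiniteField.card F (ringChar F)
  rw [h]
  exact Nat.le_self_pow n.ne_zero _

end NoLonelyOfAlg

/-- Stub 4 (plumbing): the formula version of "no lonely generic point for definable translates"
from (i) the normal form for ring formulas over large finite fields and (ii) the algebraic version
for normal-form sets. -/
theorem stub_noLonely_of_alg
    (hNF : (∀ (m n : ℕ) (φ : FirstOrder.Language.ring.Formula (Fin m ⊕ Fin n)),
        ∃ (L D Q : ℕ), ∀ (F : Type) [Field F] [Fintype F] [FirstOrder.Ring.CompatibleRing F],
        Q ≤ Fintype.card F → ∀ (y : Fin n → F), ∃ G : Fin L → MvPolynomial (Fin (m + 1)) F,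
          (∀ l, (G l).totalDegree ≤ D) ∧
          ∀ w : Fin m → F, (φ.Realize (Sum.elim w y) ↔
            ∀ l, ∃ t : F, MvPolynomial.eval (Fin.snoc w t : Fin (m + 1) → F) (G l) = 0)))
    (hA : (∀ (m L L' D : ℕ), ∃ (K Q : ℕ) (C₀ : ℝ), ∀ (F : Type) [Field F] [Fintype F],
        Q ≤ ringChar F → ∀ (G : Fin L → MvPolynomial (Fin (m + 1)) F),
          (∀ l, (G l).totalDegree ≤ D) → ∃ E : Finset (Fin m → F),
          (E.card : ℝ) ≤ C₀ * (Fintype.card F : ℝ) ^ ((m : ℝ) - 1) ∧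
          ∀ (H : Fin L' → MvPolynomial (Fin (m + 1)) F), (∀ l, (H l).totalDegree ≤ D) →
          ∀ (T A : Finset (Fin m → F)),
            (∀ w, w ∈ T ↔ ∀ l, ∃ t : F, MvPolynomial.eval (Fin.snoc w t : Fin (m + 1) → F) (G l) = 0) →
            (∀ v, v ∈ A ↔ ∀ l, ∃ t : F, MvPolynomial.eval (Fin.snoc v t : Fin (m + 1) → F) (H l) = 0) →
            K < A.card → ∀ t₀ ∈ T, t₀ ∉ E → ∃ a₀ ∈ A, ∃ a ∈ A, a ≠ a₀ ∧ t₀ + a - a₀ ∈ T)) :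
    (∀ (m n n' : ℕ) (τ : FirstOrder.Language.ring.Formula (Fin m ⊕ Fin n))
        (α : FirstOrder.Language.ring.Formula (Fin m ⊕ Fin n')),
        ∃ (K Q : ℕ) (C₀ : ℝ), ∀ (F : Type) [Field F] [Fintype F] [FirstOrder.Ring.CompatibleRing F],
        Q ≤ ringChar F → ∀ (y : Fin n → F), ∃ E : Finset (Fin m → F),
          (E.card : ℝ) ≤ C₀ * (Fintype.card F : ℝ) ^ ((m : ℝ) - 1) ∧
          ∀ (y' : Fin n' → F) (T A : Finset (Fin m → F)),
            (∀ w, w ∈ T ↔ τ.Realize (Sum.elim w y)) →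
            (∀ v, v ∈ A ↔ α.Realize (Sum.elim v y')) →
            K < A.card → ∀ t ∈ T, t ∉ E → ∃ a₀ ∈ A, ∃ a ∈ A, a ≠ a₀ ∧ t + a - a₀ ∈ T) := by
  intro m n n' τ α
  -- normal-form data of `τ` and `α`
  obtain ⟨L, D, Q, hτ⟩ := hNF m n τ
  obtain ⟨L', D', Q', hα⟩ := hNF m n' α
  -- the algebraic statement at the common degree bound `max D D'`
  obtain ⟨K, Q'', C₀, hK⟩ := hA m L L' (max D D')
  refine ⟨K, max (max Q Q') Q'', C₀, ?_⟩
  intro F _ _ _ hQF y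
  have hcard : ringChar F ≤ Fintype.card F := NoLonelyOfAlg.ringChar_le_card F
  have hQ : Q ≤ Fintype.card F :=
    le_trans (le_trans (le_max_left Q Q') (le_max_left _ Q'')) (le_trans hQF hcard)
  have hQ' : Q' ≤ Fintype.card F :=
    le_trans (le_trans (le_max_right Q Q') (le_max_left _ Q'')) (le_trans hQF hcard)
  have hQ'' : Q'' ≤ ringChar F := le_trans (le_max_right _ _) hQF
  -- the polynomials cutting out `T`
  obtain ⟨G, hGdeg, hGiff⟩ := hτ F hQ y
  obtain ⟨E, hEcard, hE⟩ := hK F hQ'' G (fun l => le_trans (hGdeg l) (le_max_left _ _))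
  refine ⟨E, hEcard, ?_⟩
  intro y' T A hT hAset hKA t ht htE
  -- the polynomials cutting out `A`
  obtain ⟨H, hHdeg, hHiff⟩ := hα F hQ' y'
  exact hE H (fun l => le_trans (hHdeg l) (le_max_right _ _)) T A
    (fun w => (hT w).trans (hGiff w)) (fun v => (hAset v).trans (hHiff v)) hKA t ht htE

end Summit.MatrixMultiplication.MatrixMultiplication.Theorems.HexagonClearanceR
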